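import Literature.AnabelianGeometry.SemiGraphs.PSCSmoothProperGenuineOrigin
import Literature.AnabelianGeometry.SemiGraphs.ProSigmaCompletionQuotientTransfer
import Literature.AnabelianGeometry.SemiGraphs.ProSigmaCompletionTransport
import Literature.AnabelianGeometry.SemiGraphs.PSCGraphicitySub
import Literature.Topology.FourManifolds.SurfaceGroupAbelianisationKernels
import HarnessLib

/-!
# [CombGC] Rmk. 1.1.5 at the genuine smooth-proper origin: `M_G = Π^{ab}` is the pro-`Σ` completion of `ℤ^{2g}`

Mochizuki, *A combinatorial version of the Grothendieck conjecture* [CombGC], Tohoku Math. J. **59**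
(2007), §1, Def. 1.1 (ii) / Rmk. 1.1.5 p. 8: for `G` of pro-`Σ` PSC-type, "`M_G := Π_G^{ab}`"; the image
`M_G[v]` of a verticial subgroup "is a free `Ẑ^Σ`-module of rank `2 g_v`" — typed by abc-iut-w4-d052 /
abc-iut-L3-t4 as `PSCDatum.UnrVertAbOfRank` ("`∃ ι : ℤ^{2 g_v} → M^unr_G[v]`, a pro-`Σ` completion")
and, over the origin parameter, `UnrVertAbOfRankHolds Ω`. [cite: MochizukiCombGC2007, Rmk 1.1.5 p.8]

PROOF-ONLY file (abc-iut cell, layer L3, [CombGC] non-vacuity programme; seat abc-iut-w5-d195 gen 6;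
sequel of `PSCSmoothProperGenuineOrigin.lean` and `ProSigmaCompletionQuotientTransfer.lean`).  At a
GENUINE smooth-proper datum — profinite `Π`, one vertex with `Π_v = Π`, no nodes, no cusps, a pro-`Σ`
completion `ι : S_g → Π` of the closed surface group, `genus(v) = g` —

* `unrKer_eq_bot_of_isEmpty`, `unrAbKer_eq_closure_commutator` — with no edges `Ker(Π ↠ Π^unr) = 1`
  and the kernel of `Π ↠ M^unr` is the closure of `[Π,Π]`;
* `unrVertAbOfRank_of_smoothProperGenuine` — **`UnrVertAbOfRank` HOLDS**: `M^unr_G[v] = Π ⧸ closure[Π,Π]`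
  is the pro-`Σ` completion of `S_g^{ab} ≅ ℤ^{2g}` (`IsProSigmaCompletion.quotientMap_of_coe_eq_closure`
  + `topologicalClosure_map_commutator_eq` + the tree's Hurewicz theorem `SurfaceGroup.ker_abelianize` /
  `abelianize_surjective`, `H₁(S_g) = ℤ^{2g}`);
* `exists_smoothProperGenuineOrigin_rank_holds` — at the covering-closed genuine smooth-proper origin of
  `PSCSmoothProperGenuineOrigin.lean` (inhabited by `Ŝ₂`), **`RestrictBDOfPSCTypeHolds Ω ∧
  UnrVertAbOfRankHolds Ω ∧ UnrVerticialCharacterizationHolds' Ω`** hold together with profiniteness —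
  the input family of the [CombGC] Thm 1.6 (iii) / Prop 1.2 derivations (abc-iut-f-165/f-166,
  abc-iut-w4-d052) is jointly satisfiable at GENUINE data (the item abc-iut-f-165 named 2026-08-26).

Consistency / non-vacuity evidence at genuine one-component data; not the printed theorems for all
pointed stable curves; nothing here takes a side on [IUTchIII] Cor. 3.12.
-/

noncomputable section

namespace Literature.AnabelianGeometry.SemiGraphs

namespace PSCDatum

open scoped Pointwise
open Literature.Topology.FourManifolds (SurfaceGroup surfaceGen)
open SemiGraphOfAnabelioids (IsProSigmaCompletion)
open Literature.IUT.HodgeTheaters (profiniteCompletion toCompletion)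

universe u

variable {P : Type u} [Group P] [TopologicalSpace P] [IsTopologicalGroup P]

/-! ### The unramified kernels at data without edges -/

/-- With no nodes and no cusps, `Ker(Π_G ↠ Π^unr_G) = 1` (Hausdorff `Π`).
[cite: MochizukiCombGC2007, Def 1.1(ii) p.7] -/
theorem unrKer_eq_bot_of_isEmpty [T1Space P] (G : PSCDatum P) [IsEmpty G.graph.N] [IsEmpty G.graph.C] :
    G.unrKer = ⊥ := by
  unfold unrKer
  have h0 : ((⋃ c, (G.cuspGp c : Set P)) ∪ ⋃ e, (G.nodeGp e : Set P)) = ∅ := by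
    simp [Set.iUnion_of_empty]
  rw [h0, Subgroup.normalClosure_empty]
  refine le_antisymm (Subgroup.topologicalClosure_minimal _ le_rfl ?_) bot_le
  rw [Subgroup.coe_bot]
  exact isClosed_singleton

/-- With no edges, the kernel of `Π_G ↠ M^unr_G` is the closure of the commutator subgroup.
[cite: MochizukiCombGC2007, Rmk 1.1.5 p.8] -/
theorem unrAbKer_eq_closure_commutator [T1Space P] (G : PSCDatum P) [IsEmpty G.graph.N]
    [IsEmpty G.graph.C] : G.unrAbKer = (commutator P).topologicalClosure := by
  rw [unrAbKer, G.unrKer_eq_bot_of_isEmpty, sup_bot_eq, commutator_def]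

/-- With `Π_v = Π`, `M^unr_G[v]` pulled back to `Π` is all of `Π`. [cite: MochizukiCombGC2007, Rmk 1.1.5 p.8] -/
theorem unrVertAbOf_eq_top (G : PSCDatum P) (hV : ∀ v, G.vertGp v = ⊤) (v : G.graph.V) :
    G.unrVertAbOf v = ⊤ := by
  rw [unrVertAbOf, hV, top_sup_eq]
  exact top_le_iff.mp (le_trans le_rfl (Subgroup.le_topologicalClosure _))

/-! ### `H₁(S_g) = ℤ^{2g}` as a multiplicative isomorphism -/

omit [TopologicalSpace P] [IsTopologicalGroup P] in
/-- `ℤ^{2g} ≅ S_g^{ab}` (Hurewicz: `SurfaceGroup.abelianize` is onto `ℤ^{surfaceGen g}` with kernel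
`[S_g,S_g]`), re-indexed along `Fin (2g) ≃ Fin g × Bool`. [cite: HatcherAT2002, §1.2 p.51] -/
theorem nonempty_mulEquiv_abelianization_surfaceGroup {n g : ℕ} (hn : n = 2 * g) :
    Nonempty (Multiplicative (Fin n → ℤ) ≃* SurfaceGroup g ⧸ commutator (SurfaceGroup g)) := by
  classical
  have hcard : Fintype.card (surfaceGen g) = n := by
    rw [hn, Fintype.card_prod, Fintype.card_fin, Fintype.card_bool, mul_comm]
  let eIdx : Fin n ≃ surfaceGen g := (Fintype.equivFinOfCardEq hcard).symm
  let eFun : Multiplicative (Fin n → ℤ) ≃* Multiplicative (surfaceGen g → ℤ) :=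
    AddEquiv.toMultiplicative (LinearEquiv.funCongrLeft ℤ ℤ eIdx).symm.toAddEquiv
  let e₂ : Multiplicative (surfaceGen g → ℤ) ≃* SurfaceGroup g ⧸ (SurfaceGroup.abelianize g).ker :=
    (QuotientGroup.quotientKerEquivOfSurjective _ (SurfaceGroup.abelianize_surjective g)).symm
  let e₃ : SurfaceGroup g ⧸ (SurfaceGroup.abelianize g).ker ≃* SurfaceGroup g ⧸ commutator (SurfaceGroup g) :=
    QuotientGroup.quotientMulEquivOfEq (SurfaceGroup.ker_abelianize g)
  exact ⟨eFun.trans (e₂.trans e₃)⟩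

/-! ### Rmk. 1.1.5 at a genuine smooth-proper datum -/

/-- **[CombGC] Rmk. 1.1.5 HOLDS at a genuine smooth-proper datum**: for `G` over a profinite `Π` with
no nodes, no cusps, `Π_v = Π`, a pro-`Σ` completion `ι : S_g → Π` (`Σ = G.Sigma`) and `genus(v) = g`,
the rank statement `UnrVertAbOfRank` holds — `M^unr_G[v] = Π ⧸ closure [Π,Π]` is the pro-`Σ`
completion of `S_g^{ab} ≅ ℤ^{2g}`. [cite: MochizukiCombGC2007, Rmk 1.1.5 p.8] -/
theorem unrVertAbOfRank_of_smoothProperGenuine [T2Space P] (G : PSCDatum P) [IsEmpty G.graph.N]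
    [IsEmpty G.graph.C] (hV : ∀ v, G.vertGp v = ⊤) {g : ℕ} (ι : SurfaceGroup g →* P)
    (hι : IsProSigmaCompletion G.Sigma ι) (hgen : ∀ v, G.genus v = g) : G.UnrVertAbOfRank := by
  intro v _
  set W : Subgroup P := G.unrVertAbOf v with hWdef
  have hW : W = ⊤ := G.unrVertAbOf_eq_top hV v
  -- `ι` co-restricted to `W = ⊤`
  have hmem : ∀ x, ι x ∈ W := fun x => by rw [hW]; exact Subgroup.mem_top _
  let ιW : SurfaceGroup g →* W := ι.codRestrict W hmem
  -- `W ≃* Π`, bi-continuous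
  let e : W ≃* P := (MulEquiv.subgroupCongr hW).trans Subgroup.topEquiv
  have he_apply : ∀ x : W, e x = (x : P) := fun _ => rfl
  have he : Continuous e := by
    have : (e : W → P) = Subtype.val := funext he_apply
    rw [this]; exact continuous_subtype_val
  have hes : Continuous e.symm := by
    have : (e.symm : P → W) = fun p => ⟨p, hW ▸ Subgroup.mem_top p⟩ := by
      funext p
      apply Subtype.ext
      change ((e (e.symm p)) : P) = p
      rw [MulEquiv.apply_symm_apply]
    rw [this]
    exact continuous_id.subtype_mk _
  have hιW : IsProSigmaCompletion G.Sigma ιW :=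
    IsProSigmaCompletion.of_target_mulEquiv hι e he hes fun _ => rfl
  -- the kernel `K = unrAbKer ∩ W` is the closure of `ιW([S_g,S_g])`
  set K : Subgroup W := (G.unrAbKer).subgroupOf W with hKdef
  have hK : (K : Set W) = closure (ιW '' ((commutator (SurfaceGroup g) : Subgroup _) : Set _)) := by
    rw [hKdef, Subgroup.coe_subgroupOf,
      Topology.IsEmbedding.subtypeVal.closure_eq_preimage_closure_image, Set.image_image]
    change Subtype.val ⁻¹' (G.unrAbKer : Set P) = Subtype.val ⁻¹' closure ((fun x => ι x) '' _)
    rw [G.unrAbKer_eq_closure_commutator,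
      ← IsProSigmaCompletion.topologicalClosure_map_commutator_eq hι.dense,
      Subgroup.topologicalClosure_coe, Subgroup.coe_map]
  have hφ := IsProSigmaCompletion.quotientMap_of_coe_eq_closure hιW (commutator (SurfaceGroup g)) K hK
  -- re-index the source along `ℤ^{2 g_v} ≅ S_g^{ab}`
  obtain ⟨eab⟩ := nonempty_mulEquiv_abelianization_surfaceGroup (n := 2 * G.genus v) (by rw [hgen])
  have hle : commutator (SurfaceGroup g) ≤ K.comap ιW :=
    IsProSigmaCompletion.le_comap_of_image_subset
      (IsProSigmaCompletion.image_subset_of_coe_eq_closure hK)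
  exact ⟨(QuotientGroup.map _ K ιW hle).comp eab.toMonoidHom,
    IsProSigmaCompletion.of_comp_mulEquiv eab (fun _ => rfl) hφ⟩

/-! ### Origin level -/

/-- **`UnrVertAbOfRankHolds` at every origin of genuine smooth-proper data.**
[cite: MochizukiCombGC2007, Rmk 1.1.5 p.8] -/
theorem unrVertAbOfRankHolds_of_smoothProperGenuine (Ω : PSCOrigin.{u})
    (hΩ : ∀ ⦃Q : Type u⦄ [Group Q] [TopologicalSpace Q] [IsTopologicalGroup Q] (G : PSCDatum Q),
      Ω.IsOfPSCType G → T2Space Q ∧ IsEmpty G.graph.N ∧ IsEmpty G.graph.C ∧ (∀ v, G.vertGp v = ⊤) ∧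
        ∃ (g : ℕ) (ι : SurfaceGroup g →* Q), IsProSigmaCompletion G.Sigma ι ∧ ∀ v, G.genus v = g) :
    UnrVertAbOfRankHolds Ω := by
  intro Q _ _ _ G hG
  obtain ⟨ht, hN, hC, hV, g, ι, hι, hgen⟩ := hΩ G hG
  exact G.unrVertAbOfRank_of_smoothProperGenuine hV ι hι hgen

/-- **The covering-closed GENUINE smooth-proper origin carries `RestrictBDOfPSCTypeHolds`,
`UnrVertAbOfRankHolds`, `UnrVerticialCharacterizationHolds'` and profiniteness together**, and is
inhabited by `Ŝ₂` — joint satisfiability, at genuine data, of the origin-level inputs of the tree's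
[CombGC] Prop 1.2 / Thm 1.6 (iii) derivations (together with the smooth-proper instance forms
F-0438/0459/0440/0443/0458/0444/0461/1931/1937 of `exists_smoothProperGenuineOrigin_holds`).
[cite: MochizukiCombGC2007, Rmk 1.1.5 p.8] -/
theorem exists_smoothProperGenuineOrigin_rank_holds :
    ∃ Ω : PSCOrigin.{0},
      (∃ G : PSCDatum (profiniteCompletion (SurfaceGroup 2)), Ω.IsOfPSCType G ∧ G.IsSturdy ∧
          (∀ v, G.vertGp v = ⊤ ∧ G.genus v = 2)) ∧
      RestrictBDOfPSCTypeHolds Ω ∧ UnrVertAbOfRankHolds Ω ∧ UnrVerticialCharacterizationHolds' Ω ∧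
      (∀ ⦃Q : Type⦄ [Group Q] [TopologicalSpace Q] [IsTopologicalGroup Q] (G : PSCDatum Q),
        Ω.IsOfPSCType G → CompactSpace Q ∧ T2Space Q ∧ TotallyDisconnectedSpace Q) ∧
      CommensurableTerminalityHolds Ω ∧ OpenInterDeterminesComponentHolds Ω ∧ UnrVerticialIffHolds Ω := by
  let Ω : PSCOrigin.{0} :=
    ⟨fun {Q} _ _ G => ∃ (_ : IsTopologicalGroup Q), CompactSpace Q ∧ T2Space Q ∧
      TotallyDisconnectedSpace Q ∧ IsEmpty G.graph.N ∧ IsEmpty G.graph.C ∧ (∀ v, G.vertGp v = ⊤) ∧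
      (∃ v₀ : G.graph.V, ∀ w, w = v₀) ∧
      ∃ (g : ℕ) (ι : SurfaceGroup g →* Q), 2 ≤ g ∧ IsProSigmaCompletion G.Sigma ι ∧ ∀ v, G.genus v = g⟩
  have hΩ : ∀ ⦃Q : Type⦄ [Group Q] [TopologicalSpace Q] (G : PSCDatum Q), Ω.IsOfPSCType G →
      IsEmpty G.graph.N ∧ IsEmpty G.graph.C ∧ (∀ v, G.vertGp v = ⊤) ∧ ∃ v₀ : G.graph.V, ∀ w, w = v₀ := by
    intro Q _ _ G hG
    obtain ⟨_, -, -, -, hN, hC, hV, hv, -⟩ := hG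
    exact ⟨hN, hC, hV, hv⟩
  have hΩ' : ∀ ⦃Q : Type⦄ [Group Q] [TopologicalSpace Q] [IsTopologicalGroup Q] (G : PSCDatum Q),
      Ω.IsOfPSCType G → T2Space Q ∧ IsEmpty G.graph.N ∧ IsEmpty G.graph.C ∧ (∀ v, G.vertGp v = ⊤) ∧
        ∃ (g : ℕ) (ι : SurfaceGroup g →* Q), IsProSigmaCompletion G.Sigma ι ∧ ∀ v, G.genus v = g := by
    intro Q _ _ _ G hG
    obtain ⟨_, -, ht, -, hN, hC, hV, -, g, ι, -, hι, hgen⟩ := hG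
    exact ⟨ht, hN, hC, hV, g, ι, hι, hgen⟩
  -- the genuine datum `Ŝ₂`
  let G : PSCDatum (profiniteCompletion (SurfaceGroup 2)) :=
    { Sigma := {p | p.Prime}
      sigma_prime := fun _ hp => hp
      sigma_nonempty := ⟨2, Nat.prime_two⟩
      graph := { V := Unit, N := Empty, C := Empty, nodeEnds := Empty.elim, cuspEnd := Empty.elim }
      vertGp := fun _ => ⊤
      nodeGp := Empty.elim
      cuspGp := Empty.elim
      genus := fun _ => 2
      isClosed_vertGp := fun _ => by rw [Subgroup.coe_top]; exact isClosed_univ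
      isClosed_nodeGp := fun e => e.elim
      isClosed_cuspGp := fun c => c.elim
      nodeGp_le := fun e => e.elim
      cuspGp_le := fun c => c.elim
      proSigma := ⟨fun _ _ _ hp _ => hp⟩ }
  have hι : IsProSigmaCompletion G.Sigma (toCompletion (SurfaceGroup 2)) :=
    IsProSigmaCompletion.isProSigmaCompletion_toCompletion (SurfaceGroup 2)
  have hG : Ω.IsOfPSCType G :=
    ⟨inferInstance, inferInstance, inferInstance, inferInstance, inferInstanceAs (IsEmpty Empty),
      inferInstanceAs (IsEmpty Empty), fun _ => rfl, ⟨(), fun _ => rfl⟩, 2, toCompletion (SurfaceGroup 2),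
      le_rfl, hι, fun _ => rfl⟩
  refine ⟨Ω, ⟨G, hG, fun _ => le_rfl, fun _ => ⟨rfl, rfl⟩⟩, ?_,
    unrVertAbOfRankHolds_of_smoothProperGenuine Ω hΩ',
    unrVerticialCharacterizationHolds'_of_smoothProper Ω hΩ, ?_,
    commensurableTerminalityHolds_of_smoothProper Ω hΩ,
    openInterDeterminesComponentHolds_of_smoothProper Ω hΩ, unrVerticialIffHolds_of_smoothProper Ω hΩ⟩
  · -- RestrictBDOfPSCTypeHolds (as in `exists_smoothProperGenuineOrigin_holds`)
    intro Q _ _ _ H hH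
    obtain ⟨_, hc, ht, hd, hN, hC, hV, ⟨v₀, hv⟩, g, ι, hg, hιH, hgen⟩ := hH
    refine ⟨H.chosenBranchData, fun U _ hU => ?_⟩
    rw [restrictBD_chosen]
    haveI : CompactSpace U := isCompact_iff_compactSpace.mp (U.isClosed_of_isOpen hU).isCompact
    obtain ⟨hN', hC', hV', hv', g', ι', hg', hι', hgen'⟩ :=
      H.restrict_smoothProperGenuine U hU hV v₀ hv hg ι hιH hgen
    exact ⟨inferInstance, inferInstance, inferInstance, inferInstance, hN', hC', hV', hv', g', ι', hg', hι',
      hgen'⟩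
  · intro Q _ _ _ H hH
    obtain ⟨_, hc, ht, hd, -⟩ := hH
    exact ⟨hc, ht, hd⟩

end PSCDatum

end Literature.AnabelianGeometry.SemiGraphs

end
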